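import Literature.AlgebraicGeometry.HodgeTheory.ComplexConjugationProofs
import Literature.AlgebraicGeometry.HodgeTheory.RealStructureSingular
import Literature.NumberTheory.Transcendental.ComplexDeRhamRealStructure
import HarnessLib

/-!
# Complexification of a real de Rham isomorphism family: the real form of de Rham's theorem

Family `hodge`, layer `Literature/AlgebraicGeometry/HodgeTheory`. Companion to
`ComplexConjugationProofs` (the named fact `exists_isReal_complexDeRhamIsoFamily E`: a natural AND
real complex de Rham isomorphism family over the manifolds charted on `E`, and the assembly
`exists_isReal_hodgeModel_of` of `exists_isReal_hodgeModel` from it), `RealStructureSingular`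
(`Hᵏ(M; ℂ) = Hᵏ(M; ℝ) ⊗ ℂ` on singular classes: `ofRealClass`, `reClass`, `imClass`) and
`Transcendental/ComplexDeRhamRealStructure` (`H^k_dR(M; ℂ) = H^k_dR(M; ℝ) ⊗ ℂ` on de Rham classes:
`complexDeRhamCohomology.ofReal`, `.re`, `.im`).

PROVED here: **the real form of de Rham's theorem with complex coefficients follows from the real
de Rham theorem** — every real de Rham isomorphism family
`e : DeRhamIsoFamily 𝓘(ℝ, E)` (`H^k_dR(M; ℝ) ≃ₗ[ℝ] Hᵏ(M; ℝ)` over the real-`C^∞`, Hausdorff,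
σ-compact manifolds charted on `E`; `Transcendental/DeRhamTheorem`) complexifies to a complex
family `e.complexify : ComplexDeRhamIsoFamily E`,
`e ⊗ ℂ : H^k_dR(M; ℂ) = H^k_dR(M; ℝ) ⊗ ℂ ≃ₗ[ℂ] Hᵏ(M; ℝ) ⊗ ℂ = Hᵏ(M; ℂ)`, concretely
`c ↦ e(re c) ⊗ 1 + i • e(im c) ⊗ 1`, which is

* an isomorphism (inverse `x ↦ e⁻¹(re x) ⊗ 1 + i • e⁻¹(im x) ⊗ 1`), `ℂ`-linear;
* REAL for every `e` (`DeRhamIsoFamily.complexify_isReal`): conjugation negates `im` on both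
  sides (`complexDeRhamCohomology.im_conj`, `imClass_conjClass`) — this is exactly Voisin's
  "complex conjugation acts naturally on `H^k(X, ℂ) = H^k(X, ℝ) ⊗ ℂ`" (Cor. 6.12);
* NATURAL when `e` is (`DeRhamIsoFamily.complexify_isNatural`): real and imaginary parts commute
  with pull-backs on both sides (`complexDeRhamCohomology.re_map`, `reClass_map`, …), the real
  pull-back calculus being available from the complex one (`PullbackFacts.real_of_complex`).

Consequences (proved): `exists_isReal_complexDeRhamIsoFamily_of_exists_deRhamIsoFamily` — the
named fact (3ℝ) of `ComplexConjugationProofs` follows from the tree's real de Rham theorem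
`Literature.NumberTheory.Transcendental.exists_deRhamIsoFamily 𝓘(ℝ, E)` (Warner Thm. 5.36 / de Rham
1931), hence is no longer a leaf of the trust base; likewise the tree's complex de Rham theorem
`exists_complexDeRhamIsoFamily E` (`exists_complexDeRhamIsoFamily_of_exists_deRhamIsoFamily`, its
docstring's "obtained from the real de Rham theorem by `⊗_ℝ ℂ` on both sides" made a theorem);
and `exists_isReal_hodgeModel_of_exists_deRhamIsoFamily`: the named fact
`exists_isReal_hodgeModel` (`ComplexConjugation`) follows from the REAL de Rham theorem, the
Kähler property of smooth projective analytifications and the Hodge decomposition of compact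
Kähler manifolds — the same trust base as the weaker `nonempty_hodgeModel`
(`HodgeModelExistenceProofs.nonempty_hodgeModel_of`, whose (3) is implied by the real theorem too).

## References

* C. Voisin, *Hodge Theory and Complex Algebraic Geometry I* (2002), §4.3.2 (Thm. 4.47,
  Rem. 4.48), §6.1.3 Cor. 6.12.
* F. W. Warner, *Foundations of Differentiable Manifolds and Lie Groups* (1983), Thm. 5.36.
* G. de Rham (1931).
-/

noncomputable section

open scoped Manifold ContDiff
open CategoryTheory

universe u

namespace Literature.AlgebraicGeometry.HodgeTheory

section HodgeTheory

open Literature.NumberTheory.Transcendental (DeRhamIsoFamily ComplexDeRhamIsoFamily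
  complexDeRhamCohomology PullbackFacts conj_mem_cclosedSmoothForms_holds
  conj_mem_cexactSmoothForms_holds exists_deRhamIsoFamily exists_complexDeRhamIsoFamily)
open Literature.AlgebraicTopology.SingularHomology (singularCohomology)

variable {E : Type u} [NormedAddCommGroup E] [NormedSpace ℂ E]

/-- A complex multiple splits along `ℂ = ℝ ⊕ iℝ`: `z • c = Re z • c + Im z • (i • c)`. [folklore] -/
theorem complex_smul_eq_re_smul_add_im_smul_I_smul {V : Type*} [AddCommGroup V] [Module ℂ V]
    (z : ℂ) (c : V) : z • c = (z.re : ℂ) • c + (z.im : ℂ) • (Complex.I • c) := by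
  conv_lhs => rw [← Complex.re_add_im z]
  rw [add_smul, mul_smul]

/-! ### The complexified comparison on one manifold -/

section OneManifold

variable {M : Type u} [TopologicalSpace M] [ChartedSpace E M] [IsManifold 𝓘(ℝ, E) ∞ M]
  [T2Space M] [SigmaCompactSpace M] (e : DeRhamIsoFamily 𝓘(ℝ, E)) (k : ℕ)

/-- The complexified comparison `H^k_dR(M; ℂ) → Hᵏ(M; ℂ)` of a real de Rham isomorphism family `e`:
`c ↦ e(re c) ⊗ 1 + i • e(im c) ⊗ 1` (unbundled; see `DeRhamIsoFamily.complexifyEquiv`).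
[cite: VoisinHodgeI2002, §6.1.3 Cor. 6.12] -/
def complexifyFun (c : complexDeRhamCohomology E M k) : singularCohomology ℂ ℂ M k :=
  ofRealClass M k (e M k (complexDeRhamCohomology.re E M k c)) +
    Complex.I • ofRealClass M k (e M k (complexDeRhamCohomology.im E M k c))

/-- The inverse `Hᵏ(M; ℂ) → H^k_dR(M; ℂ)`: `x ↦ e⁻¹(re x) ⊗ 1 + i • e⁻¹(im x) ⊗ 1`.
[cite: VoisinHodgeI2002, §6.1.3 Cor. 6.12] -/
def complexifyInv (x : singularCohomology ℂ ℂ M k) : complexDeRhamCohomology E M k :=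
  complexDeRhamCohomology.ofReal E M k ((e M k).symm (reClass M k x)) +
    Complex.I • complexDeRhamCohomology.ofReal E M k ((e M k).symm (imClass M k x))

/-- `re (e_ℂ c) = e (re c)`. [folklore] -/
theorem reClass_complexifyFun (c : complexDeRhamCohomology E M k) :
    reClass M k (complexifyFun e k c) = e M k (complexDeRhamCohomology.re E M k c) := by
  rw [complexifyFun, map_add, reClass_ofRealClass, reClass_I_smul, imClass_ofRealClass, neg_zero,
    add_zero]

/-- `im (e_ℂ c) = e (im c)`. [folklore] -/
theorem imClass_complexifyFun (c : complexDeRhamCohomology E M k) :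
    imClass M k (complexifyFun e k c) = e M k (complexDeRhamCohomology.im E M k c) := by
  rw [complexifyFun, map_add, imClass_ofRealClass, imClass_I_smul, reClass_ofRealClass, zero_add]

/-- `re (e_ℂ⁻¹ x) = e⁻¹ (re x)`. [folklore] -/
theorem re_complexifyInv (x : singularCohomology ℂ ℂ M k) :
    complexDeRhamCohomology.re E M k (complexifyInv e k x) = (e M k).symm (reClass M k x) := by
  rw [complexifyInv, map_add, complexDeRhamCohomology.re_ofReal, complexDeRhamCohomology.re_I_smul,
    complexDeRhamCohomology.im_ofReal, neg_zero, add_zero]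

/-- `im (e_ℂ⁻¹ x) = e⁻¹ (im x)`. [folklore] -/
theorem im_complexifyInv (x : singularCohomology ℂ ℂ M k) :
    complexDeRhamCohomology.im E M k (complexifyInv e k x) = (e M k).symm (imClass M k x) := by
  rw [complexifyInv, map_add, complexDeRhamCohomology.im_ofReal, complexDeRhamCohomology.im_I_smul,
    complexDeRhamCohomology.re_ofReal, zero_add]

/-- `e_ℂ⁻¹ (e_ℂ c) = c`. [folklore] -/
theorem complexifyInv_complexifyFun (c : complexDeRhamCohomology E M k) :
    complexifyInv e k (complexifyFun e k c) = c := by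
  rw [complexifyInv, reClass_complexifyFun, imClass_complexifyFun, LinearEquiv.symm_apply_apply,
    LinearEquiv.symm_apply_apply, complexDeRhamCohomology.ofReal_re_add_I_smul_ofReal_im]

/-- `e_ℂ (e_ℂ⁻¹ x) = x`. [folklore] -/
theorem complexifyFun_complexifyInv (x : singularCohomology ℂ ℂ M k) :
    complexifyFun e k (complexifyInv e k x) = x := by
  rw [complexifyFun, re_complexifyInv, im_complexifyInv, LinearEquiv.apply_symm_apply,
    LinearEquiv.apply_symm_apply, ofRealClass_reClass_add_I_smul]

/-- `e_ℂ` is additive. [folklore] -/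
theorem complexifyFun_add (c c' : complexDeRhamCohomology E M k) :
    complexifyFun e k (c + c') = complexifyFun e k c + complexifyFun e k c' := by
  simp only [complexifyFun, map_add, smul_add]
  abel

/-- `e_ℂ` commutes with real scalars. [folklore] -/
theorem complexifyFun_coe_smul (r : ℝ) (c : complexDeRhamCohomology E M k) :
    complexifyFun e k ((r : ℂ) • c) = (r : ℂ) • complexifyFun e k c := by
  rw [complexifyFun, complexDeRhamCohomology.re_coe_smul, complexDeRhamCohomology.im_coe_smul,
    (e M k).map_smul, (e M k).map_smul, ofRealClass_smul, ofRealClass_smul, complexifyFun, smul_add,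
    smul_comm (r : ℂ) Complex.I]

/-- `e_ℂ` commutes with `i`: `e_ℂ (i • c) = i • e_ℂ c` (`i • i = -1` on both sides). [folklore] -/
theorem complexifyFun_I_smul (c : complexDeRhamCohomology E M k) :
    complexifyFun e k (Complex.I • c) = Complex.I • complexifyFun e k c := by
  rw [complexifyFun, complexDeRhamCohomology.re_I_smul, complexDeRhamCohomology.im_I_smul, map_neg,
    map_neg, complexifyFun, smul_add, smul_smul, Complex.I_mul_I, neg_one_smul, add_comm]

/-- `e_ℂ` is `ℂ`-linear. [folklore] -/
theorem complexifyFun_smul (z : ℂ) (c : complexDeRhamCohomology E M k) :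
    complexifyFun e k (z • c) = z • complexifyFun e k c := by
  rw [complex_smul_eq_re_smul_add_im_smul_I_smul z c, complexifyFun_add, complexifyFun_coe_smul,
    complexifyFun_coe_smul, complexifyFun_I_smul,
    ← complex_smul_eq_re_smul_add_im_smul_I_smul z (complexifyFun e k c)]

variable (M) in
/-- **The complexified comparison `e ⊗ ℂ : H^k_dR(M; ℂ) ≃ₗ[ℂ] Hᵏ(M; ℂ)`** of a real de Rham
isomorphism family `e` on the manifold `M`: `c ↦ e(re c) ⊗ 1 + i • e(im c) ⊗ 1`, a `ℂ`-linear
isomorphism with inverse `x ↦ e⁻¹(re x) ⊗ 1 + i • e⁻¹(im x) ⊗ 1`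
(`H^k_dR(M; ℂ) = H^k_dR(M; ℝ) ⊗ ℂ`, `Hᵏ(M; ℂ) = Hᵏ(M; ℝ) ⊗ ℂ`). Deliberate dot-notation extension
of `Literature.NumberTheory.Transcendental.DeRhamIsoFamily` (`Transcendental/DeRhamTheorem`) from
the directory of its singular-side input `RealStructureSingular`.
[cite: VoisinHodgeI2002, §4.3.2 Rem. 4.48 and §6.1.3 Cor. 6.12] -/
def _root_.Literature.NumberTheory.Transcendental.DeRhamIsoFamily.complexifyEquiv :
    complexDeRhamCohomology E M k ≃ₗ[ℂ] singularCohomology ℂ ℂ M k where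
  toFun := complexifyFun e k
  map_add' := complexifyFun_add e k
  map_smul' := complexifyFun_smul e k
  invFun := complexifyInv e k
  left_inv := complexifyInv_complexifyFun e k
  right_inv := complexifyFun_complexifyInv e k

/-- `e.complexifyEquiv M k c = e(re c) ⊗ 1 + i • e(im c) ⊗ 1` (definitional). [folklore] -/
@[simp]
theorem complexifyEquiv_apply (c : complexDeRhamCohomology E M k) :
    e.complexifyEquiv M k c = complexifyFun e k c :=
  rfl

/-- `(e.complexifyEquiv M k)⁻¹ x = e⁻¹(re x) ⊗ 1 + i • e⁻¹(im x) ⊗ 1` (definitional). [folklore] -/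
@[simp]
theorem complexifyEquiv_symm_apply (x : singularCohomology ℂ ℂ M k) :
    (e.complexifyEquiv M k).symm x = complexifyInv e k x :=
  rfl

/-- **`e ⊗ ℂ` extends `e`**: on a real class, `(e ⊗ ℂ)(a ⊗ 1) = (e a) ⊗ 1`.
[cite: VoisinHodgeI2002, §6.1.3 Cor. 6.12] -/
theorem complexifyFun_ofReal (a : Literature.Geometry.Kaehler.deRhamCohomology 𝓘(ℝ, E) M ℝ k) :
    complexifyFun e k (complexDeRhamCohomology.ofReal E M k a) = ofRealClass M k (e M k a) := by
  rw [complexifyFun, complexDeRhamCohomology.re_ofReal, complexDeRhamCohomology.im_ofReal, map_zero,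
    map_zero, smul_zero, add_zero]

/-- **`e ⊗ ℂ` is real**: it intertwines conjugation of forms and conjugation of cochain values,
`conj ((e ⊗ ℂ) c) = (e ⊗ ℂ) (conj c)`, for EVERY real family `e` (conjugation negates the
imaginary part on both sides). [cite: VoisinHodgeI2002, §6.1.3 Cor. 6.12] -/
theorem conjClass_complexifyFun (c : complexDeRhamCohomology E M k) :
    conjClass M k (complexifyFun e k c) =
      complexifyFun e k (complexDeRhamCohomology.conj E M k conj_mem_cclosedSmoothForms_holds
        conj_mem_cexactSmoothForms_holds c) := by
  rw [complexifyFun, complexifyFun, complexDeRhamCohomology.re_conj,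
    complexDeRhamCohomology.im_conj, map_neg, map_neg, smul_neg, conjClass_add, conjClass_smul,
    conjClass_ofRealClass, conjClass_ofRealClass, Complex.conj_I, neg_smul]

end OneManifold

/-! ### The complexified family: real, and natural when `e` is -/

/-- **The complexification `e ⊗ ℂ` of a real de Rham isomorphism family** over the manifolds
charted on the complex normed space `E` (with its underlying real structure): a complex de Rham
isomorphism family `ComplexDeRhamIsoFamily E`. Deliberate dot-notation extension of
`Literature.NumberTheory.Transcendental.DeRhamIsoFamily`.
[cite: VoisinHodgeI2002, §4.3.2 Rem. 4.48 and §6.1.3 Cor. 6.12] -/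
def _root_.Literature.NumberTheory.Transcendental.DeRhamIsoFamily.complexify
    (e : DeRhamIsoFamily 𝓘(ℝ, E)) : ComplexDeRhamIsoFamily E :=
  fun M _ _ _ _ _ k ↦ e.complexifyEquiv M k

/-- Unfolding of the complexified family at a manifold, degree and class. [folklore] -/
@[simp]
theorem complexify_apply (e : DeRhamIsoFamily 𝓘(ℝ, E)) (M : Type u) [TopologicalSpace M]
    [ChartedSpace E M] [IsManifold 𝓘(ℝ, E) ∞ M] [T2Space M] [SigmaCompactSpace M] (k : ℕ)
    (c : complexDeRhamCohomology E M k) : e.complexify M k c = complexifyFun e k c :=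
  rfl

/-- **`e ⊗ ℂ` is a REAL family, for every real de Rham isomorphism family `e`**
(`ComplexDeRhamIsoFamily.IsReal`). [cite: VoisinHodgeI2002, §6.1.3 Cor. 6.12] -/
theorem _root_.Literature.NumberTheory.Transcendental.DeRhamIsoFamily.complexify_isReal
    (e : DeRhamIsoFamily 𝓘(ℝ, E)) : e.complexify.IsReal :=
  fun M _ _ _ _ _ k c ↦ conjClass_complexifyFun (M := M) e k c

/-- **`e ⊗ ℂ` is natural when `e` is**: for a `C^∞` map `f`,
`(e ⊗ ℂ)_M (f^* c) = f^* ((e ⊗ ℂ)_N c)`, because `re`, `im`, `⊗ 1` commute with `f^*` on de Rham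
classes (`complexDeRhamCohomology.re_map`, …, under the real pull-back calculus supplied by
`PullbackFacts.real_of_complex`) and on singular classes (`ofRealClass_map`), and `e` is natural.
[cite: VoisinHodgeI2002, §4.3.2 Rem. 4.48] -/
theorem _root_.Literature.NumberTheory.Transcendental.DeRhamIsoFamily.complexify_isNatural
    {e : DeRhamIsoFamily 𝓘(ℝ, E)} (he : e.IsNatural) : e.complexify.IsNatural := by
  intro M N _ _ _ _ _ _ _ _ _ _ _ f hf k c
  haveI : PullbackFacts 𝓘(ℝ, E) M 𝓘(ℝ, E) N ℝ := PullbackFacts.real_of_complex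
  rw [complexify_apply, complexify_apply, complexifyFun, complexDeRhamCohomology.re_map,
    complexDeRhamCohomology.im_map, he M N f hf k, he M N f hf k, ofRealClass_map, ofRealClass_map,
    complexifyFun, map_add, map_smul]

/-! ### Consequences: the real form of de Rham's theorem, and real Hodge models -/

/-- **The real form of de Rham's theorem with complex coefficients follows from the real de Rham
theorem**: `exists_deRhamIsoFamily 𝓘(ℝ, E)` (a natural — and multiplicative, normalised — real
family; Warner Thm. 5.36) implies `exists_isReal_complexDeRhamIsoFamily E` (a natural and real
complex family), by complexification.
[cite: VoisinHodgeI2002, §4.3.2 Rem. 4.48 and §6.1.3 Cor. 6.12] -/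
theorem exists_isReal_complexDeRhamIsoFamily_of_exists_deRhamIsoFamily [FiniteDimensional ℂ E]
    (h : exists_deRhamIsoFamily 𝓘(ℝ, E)) : exists_isReal_complexDeRhamIsoFamily E := by
  obtain ⟨e, he, -, -⟩ := h
  exact ⟨e.complexify, DeRhamIsoFamily.complexify_isNatural he, e.complexify_isReal⟩

/-- **The tree's complex de Rham theorem follows from the real one** ("obtained from the real
de Rham theorem by `⊗_ℝ ℂ` on both sides", docstring of `exists_complexDeRhamIsoFamily`, now a
theorem): `exists_deRhamIsoFamily 𝓘(ℝ, E) → exists_complexDeRhamIsoFamily E`.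
[cite: VoisinHodgeI2002, §4.3.2 Rem. 4.48] -/
theorem exists_complexDeRhamIsoFamily_of_exists_deRhamIsoFamily [FiniteDimensional ℂ E]
    (h : exists_deRhamIsoFamily 𝓘(ℝ, E)) : exists_complexDeRhamIsoFamily E :=
  (exists_isReal_complexDeRhamIsoFamily_of_exists_deRhamIsoFamily h).exists_complexDeRhamIsoFamily

/-- **Reduction of the named fact `exists_isReal_hodgeModel` to the REAL de Rham theorem, the
Kähler property of smooth projective analytifications and the Hodge decomposition.** If (3ᵣ) de
Rham's theorem `exists_deRhamIsoFamily 𝓘(ℝ, E)` holds for every finite-dimensional complex model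
space `E` (with its underlying real structure; Warner Thm. 5.36), (4a) analytifications of smooth
projective complex varieties are Kähler
(`isKaehlerManifold_of_isAnalytification_of_isClosedImmersion`, Voisin I §3.3.2) and (4b) compact
Kähler manifolds have the Hodge decomposition (`isInternal_hodgePQ`, Voisin I §6.1.3 Prop. 6.11),
then every smooth projective `X/ℂ` has a REAL Hodge model (`exists_isReal_hodgeModel_of` fed with
the complexified family, `exists_isReal_complexDeRhamIsoFamily_of_exists_deRhamIsoFamily`). The
trust base of `exists_isReal_hodgeModel` is thereby that of the weaker `nonempty_hodgeModel`.
[cite: SerreGAGA1956, §2 n°5 Prop. 2 and n°7 Prop. 6]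
[cite: VoisinHodgeI2002, §4.3.2 Rem. 4.48, §6.1.3 Prop. 6.11 and Cor. 6.12] -/
theorem exists_isReal_hodgeModel_of_exists_deRhamIsoFamily
    (h3 : ∀ (E : Type) [NormedAddCommGroup E] [NormedSpace ℂ E] [FiniteDimensional ℂ E],
      exists_deRhamIsoFamily 𝓘(ℝ, E))
    (h4a : ∀ (n : ℕ) (X : Motives.SchemeOver ℂ) (E : Type) [NormedAddCommGroup E]
      [NormedSpace ℂ E] [FiniteDimensional ℂ E] (M : Type) [TopologicalSpace M] [ChartedSpace E M]
      (φ : M → Motives.ComplexPoints X),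
      Motives.isKaehlerManifold_of_isAnalytification_of_isClosedImmersion
        (X := X) (d := n) (E := E) (M := M) (φ := φ))
    (h4b : ∀ (E : Type) [NormedAddCommGroup E] [NormedSpace ℂ E] [FiniteDimensional ℂ E]
      (M : Type) [TopologicalSpace M] [ChartedSpace E M] [IsManifold 𝓘(ℝ, E) ∞ M],
      Motives.isInternal_hodgePQ (E := E) (M := M)) :
    exists_isReal_hodgeModel :=
  exists_isReal_hodgeModel_of
    (fun n ↦ exists_isReal_complexDeRhamIsoFamily_of_exists_deRhamIsoFamily (h3 (Fin n → ℂ)))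
    h4a h4b

/-- Under the same three hypotheses the weaker named fact `nonempty_hodgeModel n X` follows as
well. [cite: SerreGAGA1956, §2 n°5 Prop. 2] -/
theorem nonempty_hodgeModel_of_exists_deRhamIsoFamily
    (h3 : ∀ (E : Type) [NormedAddCommGroup E] [NormedSpace ℂ E] [FiniteDimensional ℂ E],
      exists_deRhamIsoFamily 𝓘(ℝ, E))
    (h4a : ∀ (n : ℕ) (X : Motives.SchemeOver ℂ) (E : Type) [NormedAddCommGroup E]
      [NormedSpace ℂ E] [FiniteDimensional ℂ E] (M : Type) [TopologicalSpace M] [ChartedSpace E M]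
      (φ : M → Motives.ComplexPoints X),
      Motives.isKaehlerManifold_of_isAnalytification_of_isClosedImmersion
        (X := X) (d := n) (E := E) (M := M) (φ := φ))
    (h4b : ∀ (E : Type) [NormedAddCommGroup E] [NormedSpace ℂ E] [FiniteDimensional ℂ E]
      (M : Type) [TopologicalSpace M] [ChartedSpace E M] [IsManifold 𝓘(ℝ, E) ∞ M],
      Motives.isInternal_hodgePQ (E := E) (M := M)) (n : ℕ) (X : Motives.SchemeOver ℂ) :
    nonempty_hodgeModel n X :=
  (exists_isReal_hodgeModel_of_exists_deRhamIsoFamily h3 h4a h4b).nonempty_hodgeModel n X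

end HodgeTheory

end Literature.AlgebraicGeometry.HodgeTheory

end
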